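import Summits.HubbardSuperconductivity.HubbardSuperconductivity.Theorems.BalabanIRBirGroundStateAverageLROBounds
import Literature.MathematicalPhysics.QuantumLattice.HubbardGrandCanonicalDensity
import Literature.MathematicalPhysics.QuantumLattice.FinDimSpectrumSectorGibbsLimit
import Summits.HubbardSuperconductivity.HubbardSuperconductivity.Theorems.NoGoNogoSingletPairKillsSaturatedFM

/-!
# Disproof of `BirGroundStateAverageLRO` — standing adversary's work file (crux `stmt-HubbardSuperconductivity-2079`)

Crux (route `BalabanIR`, target / rank 0):
`∃ δ ∈ (0,1/2), ∃ 0 < U₁ < U₂, ∃ c > 0, ∀ U ∈ (U₁,U₂), ∃ L₀, ∀ even L ≥ L₀: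
   c·L⁴·Re tr P ≤ Re tr (P Δ_d† Δ_d)`,
`P` = projection onto the ground eigenspace of `hubbardTorus 2 L 1 U` in the sector
`(N, S^z) = (2⌊(1-δ)L²/2⌋, 0)`, `Δ_d = pairField dWaveFormFactor L`.

## Findings (cycle 1, 2026-08-16) — NO KILL

* **Typing / vacuity.** rc 0; every symbol is honest (no junk reached): `minEnergyOn` is an
  attained infimum here and `E₀ ≠ ⊥` (`hubbardTorus_groundEigenspace_ne_bot`, tree), so
  `Re tr P ≥ 1` (`one_le_re_trace_groundProj_hubbardTorus`, tree) and the inequality is never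
  `0 ≤ 0`; `0 ≤ Re tr (P Δ†Δ) ≤ C_d² L⁴ Re tr P` (`re_trace_sectorGroundProj_mul_pairField_mem_Icc`,
  tree). Restated with explicit parameters below (`AvgBoundAt`, `crux_iff`).
* **Tightness (§2, proved).** `C_d ≤ 4√2`, so ANY admissible constant has `c ≤ 32`
  (`const_le_of_witness`, `not_crux_with_large_const`): the exponent `L⁴` is saturated at most and
  nothing above `32` can be asked.
* **Load-bearing hypothesis `0 < U₁` (§3, proved modulo a free-fermion energy inequality).**
  The natural strengthening `BirGroundStateAverageLROFromZero` (window `(0, U₂)`, constant `c`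
  UNIFORM down to `U → 0⁺`) is FALSE granted `FreeDWavePairingCostsEnergy` (BCS asymptotics: a
  state of the free Fermi sea carrying `d`-wave pair LRO of density `a` pays kinetic energy
  `≥ η(a)·L²`): a sector ground state at coupling `U` has free energy excess `≤ U·L²`
  (`re_free_energy_groundState_le`, variational principle + `0 ≤ Σ n↑n↓ ≤ L²`), hence `η(c) ≤ U`
  for every `U` in the window — `window_floor_of_costs : η(c) ≤ U₁` — and a window reaching `0⁺`
  is impossible (`fromZero_false_of_costs`). Moral for provers: `c` must degrade with `U₁`
  (on paper `c(U₁) ≲ U₁ log(1/U₁)`), consistent with `PerturbativeInvisibilityOfPairing`; the crux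
  rightly asks `0 < U₁` and lets `c` depend on the window.
* **`U = 0` itself (§4, near-miss, sorry).** Free fermions have NO GS-average pair LRO:
  `Re tr (P₀ Δ_d†Δ_d) ≤ 32·L²·Re tr P₀` (plane-wave Slater basis of the free sector ground space +
  Wick: `⟨Δ_d†Δ_d⟩_SD = 2 Σ_k γ_k² n_{k↑} n_{-k↓} ≤ 32 L²`). Not closable here: the tree has no
  momentum-space CAR / Wick theorem for `HubbardWave0.annihilation`. Recorded as
  `not_avgBoundAt_zero_coupling` (sorry) — it is the `U₁ = 0` endpoint of §3 made unconditional.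
* **Incompatibility (§6, proved).** The average bound at `(δ,U,c,L)`, `c > 0`, yields a sector
  ground state that is NOT a saturated ferromagnet (singlet `Δ_d` kills saturated states — tree,
  route NoGo): a witness window is disjoint from any Nagaoka-type phase of the sector.
* **Small models.** `L = 2`: `N = 2` for every `δ ∈ (0,1/2)`; the 2-electron plaquette ground state
  is an `A₁` singlet while `Δ_d |ψ⟩ ∈ ℂ|0⟩` transforms as `B₁`, so `Re tr (P Δ_d†Δ_d) = 0` at `L = 2`
  — only says `L₀ > 2` (the crux has `∃ L₀`); not pursued in Lean (256-dim complex matrices, no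
  `decide`). Exact diagonalisation at `L = 4` says nothing about `L → ∞` and was not queued
  (compute discipline).
* **Literature negatives (prose, §5).** Finite `T`: no pairing LRO of any symmetry in `d = 2`
  (Koma–Tasaki 1992; Su–Suzuki 1998 for `d_{x²-y²}`) — irrelevant at `T = 0`. Numerics: CPMC
  (Zhang–Carlson–Gubernatis 1997; Guerrero–Ortiz–Gubernatis 1999), AFQMC+DMRG (Qin et al. 2020,
  catalogued `PureModelStripeCompetition`: `U = 6–8`, `δ = 1/8–1/5` striped, no `d`-wave order;
  `U = 4`, `δ ≈ 1/6` "consistent with zero") see no `d`-wave LRO where they can measure; weak-coupling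
  RG (Raghu–Kivelson–Scalapino 2010; Deng et al. 2015; Šimkovic et al. 2016) predicts `d_{x²-y²}`
  order for `0.6 ≲ n < 1` at `t' = 0` with an EXPONENTIALLY small order parameter — exactly where the
  crux would be true it is numerically invisible, and where numerics are conclusive the crux's `∃`
  simply avoids the region. No rigorous `T = 0` no-go exists at any `U > 0`, `δ > 0`.
* **Why it resists.** `¬crux` = for EVERY `δ ∈ (0,1/2)` the set of couplings without GS-average
  `d`-wave LRO is dense in `(0,∞)` — a rigorous absence-of-order theorem for the 2D Hubbard ground
  state, for which no technique exists (the constructive-RG control of BGM2006 stops at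
  `T ~ e^{-c/U}`, `WeakCouplingCeiling`; it cuts both ways). The crux is the GS-average / open-window
  form of the summit itself.

Namespace rule: everything here lives in `…Cruxes.BirGroundStateAverageLRO.Disproof`; nothing in
this file asserts a Theses decl positively except the trivial comparison `fromZero_imp_crux`.
-/

noncomputable section

set_option linter.dupNamespace false

namespace Summit.HubbardSuperconductivity.HubbardSuperconductivity.Cruxes.BirGroundStateAverageLRO.Disproof

open Matrix Finset Filter
open Literature.Probability.LatticeModels Literature.MathematicalPhysics.QuantumLattice
open Summit.HubbardSuperconductivity.HubbardSuperconductivity.Theses.BalabanIR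
open Summit.HubbardSuperconductivity.HubbardSuperconductivity.Theorems
open scoped ComplexOrder

/-! ## 0. The crux with explicit parameters -/

/-- The inner predicate of the crux at doping `δ`, coupling `U`, constant `c`, side `L`:
`c·L⁴·Re tr P ≤ Re tr (P Δ_d†Δ_d)` for the sector ground projection `P` of `hubbardTorus 2 L 1 U`
(body copied verbatim from `BalabanIR.BirGroundStateAverageLRO`). -/
def AvgBoundAt (δ U c : ℝ) (L : ℕ) [NeZero L] : Prop :=
  let N : ℕ := 2 * ⌊(1 - δ) * (L : ℝ) ^ 2 / 2⌋₊
  let H := hubbardTorus 2 L 1 U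
  let S := szSector (Λ := FermionTorus 2 L) N 0
  let E₀ := S ⊓ Module.End.eigenspace (Matrix.toLin' H) ((H.minEnergyOn S : ℝ) : ℂ)
  let P := projMatrix (E₀.map (Fock.toEuclidean (ι := Orb (FermionTorus 2 L)) :
    Fock (Orb (FermionTorus 2 L)) →ₗ[ℂ] EuclideanSpace ℂ (Finset (Orb (FermionTorus 2 L)))))
  c * (L : ℝ) ^ 4 * P.trace.re ≤
    (P * ((pairField dWaveFormFactor L)ᴴ * pairField dWaveFormFactor L)).trace.re

/-- The crux, restated through `AvgBoundAt` (definitional). -/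
theorem crux_iff :
    BirGroundStateAverageLRO ↔
      ∃ δ ∈ Set.Ioo (0:ℝ) (1/2), ∃ U₁ U₂ c : ℝ, 0 < U₁ ∧ U₁ < U₂ ∧ 0 < c ∧
        ∀ U ∈ Set.Ioo U₁ U₂, ∃ L₀ : ℕ, ∀ (L : ℕ) [NeZero L], L₀ ≤ L → Even L →
          AvgBoundAt δ U c L :=
  Iff.rfl

/-! ## 1. Non-vacuity (tree facts, instantiated at the crux's data) -/

/-- `Re tr P ≥ 1` at every `(δ, U, L)` of the crux (`δ > 0 > -1`): the bound is never `0 ≤ 0`. -/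
example (L : ℕ) [NeZero L] (U δ : ℝ) (hδ : δ ∈ Set.Ioo (0:ℝ) (1/2)) :
    let N : ℕ := 2 * ⌊(1 - δ) * (L : ℝ) ^ 2 / 2⌋₊
    let H := hubbardTorus 2 L 1 U
    let S := szSector (Λ := FermionTorus 2 L) N 0
    let E₀ := S ⊓ Module.End.eigenspace (Matrix.toLin' H) ((H.minEnergyOn S : ℝ) : ℂ)
    let P := projMatrix (E₀.map (Fock.toEuclidean (ι := Orb (FermionTorus 2 L)) :
      Fock (Orb (FermionTorus 2 L)) →ₗ[ℂ] EuclideanSpace ℂ (Finset (Orb (FermionTorus 2 L)))))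
    1 ≤ P.trace.re :=
  one_le_re_trace_groundProj_hubbardTorus L 1 U δ (by linarith [hδ.1])

/-! ## 2. Tightness of the constant: `c ≤ 32` -/

/-- `|g_d(e)| ≤ 1` for the `d_{x²-y²}` form factor. -/
theorem abs_dWaveFormFactor_le_one (e : Site 2) : |dWaveFormFactor e| ≤ 1 := by
  unfold dWaveFormFactor
  split_ifs <;> norm_num

/-- The crude norm constant of `Δ_d` is at most `4√2` (four unit steps, each `|g|/√2 · 2 = √2`;
the `e = 0` term vanishes). -/
theorem dWave_normConst_le :
    (∑ e ∈ insert 0 unitSteps, ‖((dWaveFormFactor e / Real.sqrt 2 : ℝ) : ℂ)‖ * 2) ≤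
      4 * Real.sqrt 2 := by
  have hs2 : 0 < Real.sqrt 2 := Real.sqrt_pos.2 (by norm_num)
  have hterm : ∀ e : Site 2, ‖((dWaveFormFactor e / Real.sqrt 2 : ℝ) : ℂ)‖ * 2 ≤ Real.sqrt 2 := by
    intro e
    rw [Complex.norm_real, Real.norm_eq_abs, abs_div, abs_of_pos hs2, div_mul_eq_mul_div,
      div_le_iff₀ hs2, Real.mul_self_sqrt (by norm_num : (0:ℝ) ≤ 2)]
    have := abs_dWaveFormFactor_le_one e
    linarith
  have h0 : ‖((dWaveFormFactor 0 / Real.sqrt 2 : ℝ) : ℂ)‖ * 2 = 0 := by simp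
  rw [Finset.sum_insert_zero (f := fun e : Site 2 => ‖((dWaveFormFactor e / Real.sqrt 2 : ℝ) : ℂ)‖ * 2) h0]
  have hcard : (unitSteps).card ≤ 4 := by
    unfold unitSteps
    refine (Finset.card_insert_le _ _).trans ?_
    refine Nat.succ_le_succ ((Finset.card_insert_le _ _).trans ?_)
    refine Nat.succ_le_succ ((Finset.card_insert_le _ _).trans ?_)
    simp
  calc (∑ e ∈ unitSteps, ‖((dWaveFormFactor e / Real.sqrt 2 : ℝ) : ℂ)‖ * 2)
      ≤ ∑ _e ∈ unitSteps, Real.sqrt 2 := Finset.sum_le_sum fun e _ => hterm e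
    _ = (unitSteps.card : ℝ) * Real.sqrt 2 := by rw [Finset.sum_const, nsmul_eq_mul]
    _ ≤ 4 * Real.sqrt 2 := by
        have : (unitSteps.card : ℝ) ≤ 4 := by exact_mod_cast hcard
        nlinarith

/-- `C_d² ≤ 32`. -/
theorem dWave_normConst_sq_le :
    (∑ e ∈ insert 0 unitSteps, ‖((dWaveFormFactor e / Real.sqrt 2 : ℝ) : ℂ)‖ * 2) ^ 2 ≤ 32 := by
  have h := dWave_normConst_le
  have h0 : 0 ≤ ∑ e ∈ insert 0 unitSteps, ‖((dWaveFormFactor e / Real.sqrt 2 : ℝ) : ℂ)‖ * 2 :=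
    Finset.sum_nonneg fun e _ => by positivity
  calc (∑ e ∈ insert 0 unitSteps, ‖((dWaveFormFactor e / Real.sqrt 2 : ℝ) : ℂ)‖ * 2) ^ 2
      ≤ (4 * Real.sqrt 2) ^ 2 := pow_le_pow_left₀ h0 h 2
    _ = 32 := by
        rw [mul_pow, Real.sq_sqrt (by norm_num : (0:ℝ) ≤ 2)]
        norm_num

/-- **Tightness.** If the average bound holds at ONE `(δ, U, c, L)` with `δ ≥ -1` (any `L ≥ 1`),
then `c ≤ 32`: `c L⁴ tr P ≤ tr (P Δ†Δ) ≤ 32 L⁴ tr P` and `tr P ≥ 1`. -/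
theorem const_le_of_avgBoundAt {δ U c : ℝ} {L : ℕ} [NeZero L] (hδ : -1 ≤ δ)
    (h : AvgBoundAt δ U c L) : c ≤ 32 := by
  have hP := one_le_re_trace_groundProj_hubbardTorus L 1 U δ hδ
  have hup := (re_trace_sectorGroundProj_mul_pairField_mem_Icc dWaveFormFactor L
    (hubbardTorus 2 L 1 U) (2 * ⌊(1 - δ) * (L : ℝ) ^ 2 / 2⌋₊) 0).2
  simp only [AvgBoundAt] at h
  simp only at hP
  set T := (projMatrix ((szSector (2 * ⌊(1 - δ) * (L : ℝ) ^ 2 / 2⌋₊) 0 ⊓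
      Module.End.eigenspace (Matrix.toLin' (hubbardTorus 2 L 1 U))
        (((hubbardTorus 2 L 1 U).minEnergyOn (szSector (2 * ⌊(1 - δ) * (L : ℝ) ^ 2 / 2⌋₊) 0) : ℝ) :
          ℂ)).map (Fock.toEuclidean (ι := Orb (FermionTorus 2 L)) :
      Fock (Orb (FermionTorus 2 L)) →ₗ[ℂ] EuclideanSpace ℂ (Finset (Orb (FermionTorus 2 L)))))).trace.re
    with hT
  have hL : (0 : ℝ) < (L : ℝ) ^ 4 := by
    have : (0 : ℝ) < (L : ℝ) := by exact_mod_cast Nat.pos_of_ne_zero (NeZero.ne L)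
    positivity
  have hC := dWave_normConst_sq_le
  have hTpos : 0 < T := by linarith
  -- c L⁴ T ≤ C² L⁴ T with C² ≤ 32
  have h1 : c * (L : ℝ) ^ 4 * T ≤ 32 * (L : ℝ) ^ 4 * T := by
    refine h.trans (hup.trans ?_)
    have : ((∑ e ∈ insert 0 unitSteps, ‖((dWaveFormFactor e / Real.sqrt 2 : ℝ) : ℂ)‖ * 2) *
        (L : ℝ) ^ 2) ^ 2 = (∑ e ∈ insert 0 unitSteps,
          ‖((dWaveFormFactor e / Real.sqrt 2 : ℝ) : ℂ)‖ * 2) ^ 2 * (L : ℝ) ^ 4 := by ring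
    rw [this]
    have hL4T : 0 ≤ (L : ℝ) ^ 4 * T := by positivity
    nlinarith
  have hLT : 0 < (L : ℝ) ^ 4 * T := by positivity
  nlinarith

/-- **Any witness of the crux has `c ≤ 32`.** -/
theorem const_le_of_witness {δ U₁ U₂ c : ℝ} (hδ : δ ∈ Set.Ioo (0:ℝ) (1/2)) (hU : U₁ < U₂)
    (h : ∀ U ∈ Set.Ioo U₁ U₂, ∃ L₀ : ℕ, ∀ (L : ℕ) [NeZero L], L₀ ≤ L → Even L →
      AvgBoundAt δ U c L) : c ≤ 32 := by
  obtain ⟨L₀, hL₀⟩ := h ((U₁ + U₂) / 2) ⟨by linarith, by linarith⟩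
  haveI : NeZero (2 * (L₀ + 1)) := ⟨by omega⟩
  exact const_le_of_avgBoundAt (L := 2 * (L₀ + 1)) (by linarith [hδ.1])
    (hL₀ (2 * (L₀ + 1)) (by omega) (even_two_mul _))

/-- **Refuted strengthening (constant).** The crux with any constant `c > 32` is false. -/
theorem not_crux_with_large_const :
    ¬ ∃ δ ∈ Set.Ioo (0:ℝ) (1/2), ∃ U₁ U₂ c : ℝ, 0 < U₁ ∧ U₁ < U₂ ∧ 32 < c ∧
        ∀ U ∈ Set.Ioo U₁ U₂, ∃ L₀ : ℕ, ∀ (L : ℕ) [NeZero L], L₀ ≤ L → Even L →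
          AvgBoundAt δ U c L := by
  rintro ⟨δ, hδ, U₁, U₂, c, -, hU, hc, h⟩
  have := const_le_of_witness hδ hU h
  linarith

/-! ## 3. The window cannot reach `U → 0⁺` with a uniform constant -/

/-- STRENGTHENING of the crux: the window starts at `0` and `c` is uniform on `(0, U₂)`. -/
def BirGroundStateAverageLROFromZero : Prop :=
  ∃ δ ∈ Set.Ioo (0:ℝ) (1/2), ∃ U₂ c : ℝ, 0 < U₂ ∧ 0 < c ∧
    ∀ U ∈ Set.Ioo 0 U₂, ∃ L₀ : ℕ, ∀ (L : ℕ) [NeZero L], L₀ ≤ L → Even L → AvgBoundAt δ U c L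

/-- `FromZero` is indeed stronger than the crux (shrink the window to `(U₂/2, U₂)`). -/
theorem fromZero_imp_crux (h : BirGroundStateAverageLROFromZero) : BirGroundStateAverageLRO := by
  obtain ⟨δ, hδ, U₂, c, hU₂, hc, hall⟩ := h
  exact ⟨δ, hδ, U₂ / 2, U₂, c, by linarith, by linarith, hc,
    fun U hU => hall U ⟨by linarith [hU.1], hU.2⟩⟩

/-- HYPOTHESIS (free-fermion energy inequality; BCS asymptotics, believed true, NOT proved here).
`d`-wave pairing of the free Fermi sea costs kinetic energy at a volume rate: for every LRO density
`a > 0` there are `η > 0` and `L₁` such that for all sides `L ≥ L₁`, every particle number `N` and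
every unit vector `ψ` of the sector `(N, S^z = 0)` with `Re ⟨ψ, Δ_d†Δ_d ψ⟩ ≥ a L⁴`, the free
(`U = 0`) energy of `ψ` exceeds the free sector ground energy by at least `η L²`.
Paper proof sketch: for `g > 0` and the chemical potential `μ_N` of the (convex) free problem,
`⟨ψ, H₀ ψ⟩ - E₀^free(N) ≥ g a L² - [E^free_gc(μ_N) - E_gc(H₀ - μ_N N - (g/L²) Δ_d†Δ_d)]`, and the
bracket (condensation energy of the zero-pair-momentum `d`-wave reduced BCS model, `Δ_d =
√2 Σ_k (2cos k₁ - 2cos k₂) c_{k↑} c_{-k↓}`) is `≤ ε(g) L² + o(L²)` with `ε(g) = O(e^{-c/√g}) = o(g)`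
by the asymptotic exactness of BCS mean-field theory for separable reduced interactions
(Bogoliubov Jr. approximating-Hamiltonian method; Bru–de Siqueira Pedra, Mem. AMS 224 (2013)
Thm 107; cf. tree `AHM.bogoliubovJr_approximatingHamiltonian_attractive`); optimise `g`.
Quantitatively `η(a) ≳ a / log(1/a)`. [cite: BruPedra2013, Appendix, Theorem 107]
[cite: BardeenCooperSchrieffer1957] -/
def FreeDWavePairingCostsEnergy : Prop :=
  ∀ a : ℝ, 0 < a → ∃ η : ℝ, 0 < η ∧ ∃ L₁ : ℕ, ∀ (L : ℕ) [NeZero L], L₁ ≤ L →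
    ∀ (N : ℕ) (ψ : Fock (Orb (FermionTorus 2 L))),
      ψ ∈ szSector (Λ := FermionTorus 2 L) N 0 → star ψ ⬝ᵥ ψ = 1 →
      a * (L : ℝ) ^ 4 ≤
        (star ψ ⬝ᵥ ((pairField dWaveFormFactor L)ᴴ * pairField dWaveFormFactor L) *ᵥ ψ).re →
      (hubbardTorus 2 L 1 0).minEnergyOn (szSector (Λ := FermionTorus 2 L) N 0) + η * (L : ℝ) ^ 2 ≤
        (star ψ ⬝ᵥ (hubbardTorus 2 L 1 0) *ᵥ ψ).re

section Energy

variable {Λ : Type*} [LinearOrder Λ] [Fintype Λ] (G : SimpleGraph Λ) [DecidableRel G.Adj]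

/-- The on-site repulsion `D = Σ_x n_{x↑} n_{x↓}`. -/
abbrev doubleOcc : Matrix (Finset (Orb Λ)) (Finset (Orb Λ)) ℂ :=
  ∑ x : Λ, numberOp x 0 * numberOp x 1

/-- `H(t,U) = H(t,0) + U·D`. -/
theorem hamiltonian_eq_free_add (t U : ℝ) :
    hamiltonian G t U = hamiltonian G t 0 + (U : ℂ) • (doubleOcc : Matrix _ _ ℂ) := by
  have h := hamiltonianWith_sub_hamiltonianWith G t 0 U 0
  simp only [hamiltonianWith_zero, sub_zero] at h
  rw [← h]
  abel

/-- `Re ⟨ψ, H(t,U) ψ⟩ = Re ⟨ψ, H(t,0) ψ⟩ + U · Re ⟨ψ, D ψ⟩`. -/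
theorem re_expect_hamiltonian_eq (t U : ℝ) (ψ : Fock (Orb Λ)) :
    (star ψ ⬝ᵥ hamiltonian G t U *ᵥ ψ).re =
      (star ψ ⬝ᵥ hamiltonian G t 0 *ᵥ ψ).re +
        U * (star ψ ⬝ᵥ (doubleOcc : Matrix _ _ ℂ) *ᵥ ψ).re := by
  rw [hamiltonian_eq_free_add G t U, add_mulVec, smul_mulVec, dotProduct_add,
    dotProduct_smul, smul_eq_mul, Complex.add_re, Complex.re_ofReal_mul]

/-- `0 ≤ Re ⟨ψ, D ψ⟩`. -/
theorem re_expect_doubleOcc_nonneg (ψ : Fock (Orb Λ)) :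
    0 ≤ (star ψ ⬝ᵥ (doubleOcc : Matrix (Finset (Orb Λ)) _ ℂ) *ᵥ ψ).re := by
  have h := (posSemidef_sum_numberOp_mul_numberOp (Λ := Λ)).dotProduct_mulVec_nonneg ψ
  exact (Complex.nonneg_iff.1 h).1

/-- `Re ⟨ψ, D ψ⟩ ≤ |Λ| · Re ⟨ψ, ψ⟩`. -/
theorem re_expect_doubleOcc_le (ψ : Fock (Orb Λ)) :
    (star ψ ⬝ᵥ (doubleOcc : Matrix (Finset (Orb Λ)) _ ℂ) *ᵥ ψ).re ≤
      (Fintype.card Λ : ℝ) * (star ψ ⬝ᵥ ψ).re := by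
  have h := (posSemidef_card_sub_sum_numberOp_mul_numberOp (Λ := Λ)).dotProduct_mulVec_nonneg ψ
  rw [sub_mulVec, smul_mulVec, one_mulVec, dotProduct_sub, dotProduct_smul] at h
  have h' := (Complex.nonneg_iff.1 h).1
  rw [Complex.sub_re] at h'
  have hre : (((Fintype.card Λ : ℕ) : ℂ) • (star ψ ⬝ᵥ ψ)).re =
      (Fintype.card Λ : ℝ) * (star ψ ⬝ᵥ ψ).re := by
    rw [smul_eq_mul, ← Complex.ofReal_natCast, Complex.re_ofReal_mul]
  linarith [hre]

/-- For a unit eigenvector, `Re ⟨ψ, H ψ⟩` is the eigenvalue. -/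
theorem re_expect_of_eigen {n : Type*} [Fintype n] {H : Matrix n n ℂ} {ψ : n → ℂ} {e : ℝ}
    (hH : H *ᵥ ψ = ((e : ℝ) : ℂ) • ψ) (h1 : star ψ ⬝ᵥ ψ = 1) :
    (star ψ ⬝ᵥ H *ᵥ ψ).re = e := by
  rw [hH, dotProduct_smul, smul_eq_mul, h1, mul_one, Complex.ofReal_re]

end Energy

/-- **Variational upper bound on the interacting sector energy.** For `U ≥ 0` and `n ≤ L²`,
`minE(H_U, szSector (2n) 0) ≤ minE(H_0, szSector (2n) 0) + U · L²` on the torus of side `L`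
(test the interacting Hamiltonian on a free sector ground state; `0 ≤ D ≤ L²`). -/
theorem minEnergyOn_le_free_add (L : ℕ) (t U : ℝ) (hU : 0 ≤ U) {n : ℕ} (hn : n ≤ L ^ 2) :
    (hubbardTorus 2 L t U).minEnergyOn (szSector (Λ := FermionTorus 2 L) (2 * n) 0) ≤
      (hubbardTorus 2 L t 0).minEnergyOn (szSector (Λ := FermionTorus 2 L) (2 * n) 0) +
        U * (L : ℝ) ^ 2 := by
  obtain ⟨φ, hφ1, hφS, -, hHφ⟩ := NoGo.exists_unit_groundStateInSector_hubbardTorus L t 0 hn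
  have hH : (hubbardTorus 2 L t U).IsHermitian := LiebThm1.hamiltonian_isHermitian _ t U
  have hle := minEnergyOn_le_rayleigh_of_mem hH _ hφS hφ1
  have hsplit := re_expect_hamiltonian_eq (fermionTorusGraph 2 L) t U φ
  have hfree : (star φ ⬝ᵥ hubbardTorus 2 L t 0 *ᵥ φ).re =
      (hubbardTorus 2 L t 0).minEnergyOn (szSector (Λ := FermionTorus 2 L) (2 * n) 0) :=
    re_expect_of_eigen hHφ hφ1
  have hD := re_expect_doubleOcc_le (Λ := FermionTorus 2 L) φ
  rw [NoGo.card_fermionTorus_two, hφ1, Complex.one_re, mul_one] at hD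
  have hD' : U * (star φ ⬝ᵥ (doubleOcc : Matrix (Finset (Orb (FermionTorus 2 L))) _ ℂ) *ᵥ φ).re ≤
      U * (L : ℝ) ^ 2 := by
    have := mul_le_mul_of_nonneg_left hD hU
    simpa using this
  unfold hubbardTorus at *
  linarith

/-- **The free energy of an interacting sector ground state.** For `U ≥ 0`, a unit ground state
`ψ` of `hubbardTorus 2 L t U` in the sector `(2n, 0)`, `n ≤ L²`, has
`Re ⟨ψ, H_0 ψ⟩ ≤ minE(H_0, sector) + U · L²`. -/
theorem re_free_energy_groundState_le (L : ℕ) (t U : ℝ) (hU : 0 ≤ U) {n : ℕ} (hn : n ≤ L ^ 2)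
    {ψ : Fock (Orb (FermionTorus 2 L))} (hψ : IsGroundStateInSector (hubbardTorus 2 L t U) (2 * n) 0 ψ)
    (h1 : star ψ ⬝ᵥ ψ = 1) :
    (star ψ ⬝ᵥ hubbardTorus 2 L t 0 *ᵥ ψ).re ≤
      (hubbardTorus 2 L t 0).minEnergyOn (szSector (Λ := FermionTorus 2 L) (2 * n) 0) +
        U * (L : ℝ) ^ 2 := by
  obtain ⟨-, -, hHψ⟩ := hψ
  have hU' : (star ψ ⬝ᵥ hubbardTorus 2 L t U *ᵥ ψ).re =
      (hubbardTorus 2 L t U).minEnergyOn (szSector (Λ := FermionTorus 2 L) (2 * n) 0) :=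
    re_expect_of_eigen hHψ h1
  have hsplit := re_expect_hamiltonian_eq (fermionTorusGraph 2 L) t U ψ
  have hD := re_expect_doubleOcc_nonneg (Λ := FermionTorus 2 L) ψ
  have hvar := minEnergyOn_le_free_add L t U hU hn
  have hUD : 0 ≤ U * (star ψ ⬝ᵥ (doubleOcc : Matrix (Finset (Orb (FermionTorus 2 L))) _ ℂ) *ᵥ ψ).re :=
    mul_nonneg hU hD
  unfold hubbardTorus at *
  linarith

/-- **Quantitative floor for the window.** If the average bound with constant `c` holds eventually
in even `L` at EVERY coupling of an interval `(U₁, U₂)` (`U₁ ≥ 0`), and `η` is an energy-cost rate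
for `d`-wave pair LRO of density `c` in the free Fermi sea from side `L₁` on (the property asked by
`FreeDWavePairingCostsEnergy` at `a = c`), then `η ≤ U₁`: the interval cannot come closer to `0`
than `η`. -/
theorem window_floor_of_costs {δ U₁ U₂ c : ℝ}
    (hδ : δ ∈ Set.Ioo (0:ℝ) (1/2)) (hU₁ : 0 ≤ U₁) (hU : U₁ < U₂)
    (h : ∀ U ∈ Set.Ioo U₁ U₂, ∃ L₀ : ℕ, ∀ (L : ℕ) [NeZero L], L₀ ≤ L → Even L →
      AvgBoundAt δ U c L)
    {η : ℝ} {L₁ : ℕ}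
    (hη : ∀ (L : ℕ) [NeZero L], L₁ ≤ L → ∀ (N : ℕ) (ψ : Fock (Orb (FermionTorus 2 L))),
      ψ ∈ szSector (Λ := FermionTorus 2 L) N 0 → star ψ ⬝ᵥ ψ = 1 →
      c * (L : ℝ) ^ 4 ≤
        (star ψ ⬝ᵥ ((pairField dWaveFormFactor L)ᴴ * pairField dWaveFormFactor L) *ᵥ ψ).re →
      (hubbardTorus 2 L 1 0).minEnergyOn (szSector (Λ := FermionTorus 2 L) N 0) + η * (L : ℝ) ^ 2 ≤
        (star ψ ⬝ᵥ (hubbardTorus 2 L 1 0) *ᵥ ψ).re) :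
    η ≤ U₁ := by
  by_contra hlt
  push Not at hlt
  -- a coupling in the window below η
  set U := min ((U₁ + η) / 2) ((U₁ + U₂) / 2) with hUdef
  have hUmem : U ∈ Set.Ioo U₁ U₂ := by
    constructor
    · simp only [hUdef, lt_min_iff]; constructor <;> linarith
    · exact (min_le_right _ _).trans_lt (by linarith)
  have hUη : U < η := (min_le_left _ _).trans_lt (by linarith)
  have hU0 : 0 ≤ U := le_trans hU₁ hUmem.1.le
  obtain ⟨L₀, hL₀⟩ := h U hUmem
  -- a large even side
  set m := max L₀ L₁ + 1 with hm
  haveI : NeZero (2 * m) := ⟨by omega⟩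
  have hbound := hL₀ (2 * m) (by omega) (even_two_mul m)
  have hδ' : (-1 : ℝ) ≤ δ := by linarith [hδ.1]
  obtain ⟨ψ, hgs, h1, hle⟩ := exists_groundState_le_of_trace_bound (2 * m) 1 U δ c hδ' hbound
  have hn := NoGo.floor_pairNumber_le δ hδ' (2 * m)
  have hcost := hη (2 * m) (by omega) _ ψ hgs.1 h1 hle
  have hfree := re_free_energy_groundState_le (2 * m) 1 U hU0 hn hgs h1
  have hL : (0 : ℝ) < ((2 * m : ℕ) : ℝ) ^ 2 := by positivity
  have : η * ((2 * m : ℕ) : ℝ) ^ 2 ≤ U * ((2 * m : ℕ) : ℝ) ^ 2 := by linarith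
  have := le_of_mul_le_mul_right this hL
  linarith

/-- **Refuted strengthening (window from `0`), modulo the free-fermion energy inequality.**
`FreeDWavePairingCostsEnergy → ¬ BirGroundStateAverageLROFromZero`: a window `(0, U₂)` with a
uniform constant `c` would put a sector ground state with pair LRO `≥ c L⁴` at couplings
`U < η(c)`, whose free energy excess is `≤ U L² < η L²` — contradiction. So the crux's `0 < U₁`
(with `c` allowed to depend on the window) is load-bearing. -/
theorem fromZero_false_of_costs (hC : FreeDWavePairingCostsEnergy) :
    ¬ BirGroundStateAverageLROFromZero := by
  rintro ⟨δ, hδ, U₂, c, hU₂, hc, hall⟩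
  obtain ⟨η, hη, L₁, hcost⟩ := hC c hc
  have := window_floor_of_costs hδ le_rfl hU₂ hall (η := η) (L₁ := L₁)
    (fun L _ hL N ψ hS h1 hle => hcost L hL N ψ hS h1 hle)
  linarith

/-- **Corollary for the crux's own witnesses.** Granted `FreeDWavePairingCostsEnergy`, any witness
`(δ, U₁, U₂, c)` of the crux has `η(c) ≤ U₁` for the hypothesis' rate `η(c)`: the smaller the
window's left end, the smaller the admissible constant. -/
theorem crux_witness_window_floor (hC : FreeDWavePairingCostsEnergy) {δ U₁ U₂ c : ℝ}
    (hδ : δ ∈ Set.Ioo (0:ℝ) (1/2)) (hU₁ : 0 < U₁) (hU : U₁ < U₂) (hc : 0 < c)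
    (h : ∀ U ∈ Set.Ioo U₁ U₂, ∃ L₀ : ℕ, ∀ (L : ℕ) [NeZero L], L₀ ≤ L → Even L →
      AvgBoundAt δ U c L) :
    ∃ η : ℝ, 0 < η ∧ η ≤ U₁ ∧ ∃ L₁ : ℕ, ∀ (L : ℕ) [NeZero L], L₁ ≤ L →
      ∀ (N : ℕ) (ψ : Fock (Orb (FermionTorus 2 L))),
        ψ ∈ szSector (Λ := FermionTorus 2 L) N 0 → star ψ ⬝ᵥ ψ = 1 →
        c * (L : ℝ) ^ 4 ≤
          (star ψ ⬝ᵥ ((pairField dWaveFormFactor L)ᴴ * pairField dWaveFormFactor L) *ᵥ ψ).re →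
        (hubbardTorus 2 L 1 0).minEnergyOn (szSector (Λ := FermionTorus 2 L) N 0) + η * (L : ℝ) ^ 2 ≤
          (star ψ ⬝ᵥ (hubbardTorus 2 L 1 0) *ᵥ ψ).re := by
  obtain ⟨η, hη, L₁, hcost⟩ := hC c hc
  exact ⟨η, hη, window_floor_of_costs hδ hU₁.le hU h (η := η) (L₁ := L₁)
    (fun L _ hL N ψ hS h1 hle => hcost L hL N ψ hS h1 hle), L₁,
    fun L _ hL N ψ hS h1 hle => hcost L hL N ψ hS h1 hle⟩

/-! ## 4. Near-miss: the `U = 0` endpoint itself -/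

/-- NEAR-MISS (true on paper, not closable with the tree's API). At `U = 0` the GS-average bound
fails for every `δ ∈ (0,1/2)`, `c > 0`, frequently in even `L`: the free sector ground space is
spanned by plane-wave Slater determinants, on each of which Wick's rule gives
`⟨Δ_d†Δ_d⟩ = 2 Σ_k (2cos k₁ - 2cos k₂)² n_{k↑} n_{-k↓} ≤ 32 L²`, so `Re tr (P₀ Δ_d†Δ_d) ≤
32 L² Re tr P₀ < c L⁴ Re tr P₀` once `L² > 32/c`. Obstruction: no momentum-space CAR algebra /
Wick theorem for `HubbardWave0.annihilation` in the tree (the Jordan–Wigner matrices are only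
developed in position space); tried: none of `FermionQuasiFree*`, `ReducedBCSTorus` exposes the
plane-wave Slater basis of `szSector`. -/
theorem not_avgBoundAt_zero_coupling (δ c : ℝ) (hδ : δ ∈ Set.Ioo (0:ℝ) (1/2)) (hc : 0 < c)
    (L₀ : ℕ) : ∃ (L : ℕ) (_ : NeZero L), L₀ ≤ L ∧ Even L ∧ ¬ AvgBoundAt δ 0 c L := by
  sorry

/-! ## 6. Incompatibilities: the window carries no saturated ferromagnetism -/

/-- **LRO excludes saturated ferromagnetism.** If the average bound holds at `(δ, U, c, L)` with
`c > 0` (`δ ≥ -1`), then SOME normalised sector ground state of `hubbardTorus 2 L 1 U` is NOT a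
saturated ferromagnet (`S² ψ ≠ (N/2)(N/2+1) ψ`): a saturated state is killed by the singlet pair
field (`NoGo.pairField_mulVec_eq_zero_of_saturated`, tree), so it has `⟨Δ_d†Δ_d⟩ = 0 < c L⁴`.
Hence a witness window of the crux is disjoint from any (Nagaoka-type) saturated-ferromagnetic
ground-state phase of the sector — the `U → ∞`, `δ → 0⁺` corner is not where to aim
(cf. route NoGo, `nogoNagaokaWindow_of_saturatedFerromagnetism`). -/
theorem exists_groundState_not_saturated_of_avgBoundAt {δ U c : ℝ} {L : ℕ} [NeZero L]
    (hδ : -1 ≤ δ) (hc : 0 < c) (h : AvgBoundAt δ U c L) :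
    ∃ ψ : Fock (Orb (FermionTorus 2 L)),
      IsGroundStateInSector (hubbardTorus 2 L 1 U) (2 * ⌊(1 - δ) * (L : ℝ) ^ 2 / 2⌋₊) 0 ψ ∧
      star ψ ⬝ᵥ ψ = 1 ∧
      spinSq *ᵥ ψ ≠ ((((2 * ⌊(1 - δ) * (L : ℝ) ^ 2 / 2⌋₊ : ℕ) : ℝ) / 2 *
        ((((2 * ⌊(1 - δ) * (L : ℝ) ^ 2 / 2⌋₊ : ℕ) : ℝ) / 2) + 1) : ℝ) : ℂ) • ψ := by
  obtain ⟨ψ, hgs, h1, hle⟩ := exists_groundState_le_of_trace_bound L 1 U δ c hδ h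
  refine ⟨ψ, hgs, h1, fun hS => ?_⟩
  have hN : IsNParticle (2 * ⌊(1 - δ) * (L : ℝ) ^ 2 / 2⌋₊) ψ :=
    ((mem_szSector_iff _ _ ψ).1 hgs.1).1
  have hkill := Summit.HubbardSuperconductivity.NoGo.pairField_mulVec_eq_zero_of_saturated
    dWaveFormFactor L hN hS
  rw [← mulVec_mulVec, hkill, mulVec_zero, dotProduct_zero, Complex.zero_re] at hle
  have hL : (0 : ℝ) < (L : ℝ) ^ 4 := by
    have : (0 : ℝ) < (L : ℝ) := by exact_mod_cast Nat.pos_of_ne_zero (NeZero.ne L)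
    positivity
  nlinarith

/-! ## 5. Regime map for provers (prose)

* `c ≤ 32` always (§2); `c → 0` forced as `U₁ → 0` (§3; on paper `c ≲ U₁ log(1/U₁)`), and in the
  intended BCS mechanism `c ~ (ρ Δ log(W/Δ))² ~ e^{-2/(ρ_d g_eff)}` with `g_eff ~ U²`: doubly
  exponentially small in `1/U` — invisible to any numerics and to any finite-order expansion.
* `δ`: weak-coupling RG at `t' = 0` puts the `d_{x²-y²}` channel on top only for `0.6 ≲ n < 1`
  (`δ ≲ 0.4`; `d_{xy}`/`p` below; Raghu–Kivelson–Scalapino 2010 Fig. 2, Šimkovic et al. PRB 94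
  (2016) 085106, Deng et al. EPL 110 (2015) 57001) and AF/umklapp competition as `δ → 0`:
  a witness `δ` should sit in `≈ (0.1, 0.35)`.
* `U`: at `U = 6–8`, `δ = 1/8–1/5` the pure model is striped without `d`-wave order (Qin et al.
  PRX 10 (2020) 031016; catalogue `PureModelStripeCompetition`); CPMC at `U ≤ 8` on `≤ 16×16`
  (Zhang–Carlson–Gubernatis PRL 78 (1997) 4486; Guerrero–Ortiz–Gubernatis PRB 59 (1999) 1706) saw
  no long-range `d`-wave pairing correlations. None of this refutes an `∃`-window at weak `U`.
* Finite temperature is irrelevant: Koma–Tasaki (PRL 68 (1992) 3248) / Su–Suzuki (PRB 58 (1998)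
  117, arXiv:cond-mat/9801243 pp. 6–7) exclude `d_{x²-y²}` pairing LRO at `T > 0` in `d ≤ 2`; their
  `T = 0` extension needs a UNIFORM excitation gap `E_gap > 0` (`β/2 ↦ 1/E_gap`), which an ordered
  phase violates (catalogue `LROForcesLowLyingStates`) — no bite on the crux.
* `U → ∞`, `δ → 0⁺`: under (open) finite-density Nagaoka ferromagnetism the sector ground states are
  saturated and carry NO singlet pair LRO (§6; route NoGo) — a witness window must stay out of any
  such phase; nothing is proved about where (if anywhere) it sits.
-/

end Summit.HubbardSuperconductivity.HubbardSuperconductivity.Cruxes.BirGroundStateAverageLRO.Disproof
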